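import Summits.ResolutionOfSingularities.ResolutionOfSingularities.Theorems.HilbertSamuelEliminationSigmaMaxModificationsCorridor3SigmaBoundaryDefs
import Summits.ResolutionOfSingularities.ResolutionOfSingularities.Theorems.HilbertSamuelEliminationSigmaMaxModificationsCorridor3SigmaRuns
import Summits.ResolutionOfSingularities.ResolutionOfSingularities.Theorems.HilbertSamuelEliminationSigmaMaxModificationsCorridor3SigmaCycleDefs
import HarnessLib

/-!
# [OURS · L1 W4.2] σ-LAYER part 1c (re-based on res-L1-type-o1's `…Corridor3SigmaBoundaryDefs.lean` p523041): BOUNDARY-THREADED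
# point-free STATES and RUNS, lifting of reachability, and BOUNDARY-AWARE STAGE ORACLES with the boundary-blind Ω-embedding
# (cell res-hironaka, LADDER-RESOLUTION rung L; slot W4.2, crux chain w42 `SigmaMaxModificationsCorridor3`
# stmt-ResolutionOfSingularities-19249 / crux stmt-…-18506; res-L1-w42-plan-1 RULINGS v3.14-11 (CL)(i) / v3.14-11d (CU); hand
# res-D-pv-047 AS res-L1-s46-pv-10; `--supports stmt-ResolutionOfSingularities-19249 --as helper`)

HONEST FRAMING. OURS bookkeeping, ADDITIVE: nothing landed is disturbed. The boundary layer of record is res-L1-type-o1's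
`…Corridor3SigmaBoundaryDefs.lean` (p523041: `Boundary`, `Boundary.next`, `MarkedStageE`, `StrategyE`, `Strategy.withBoundary`,
`CanonicalNearStepσE`, `ReachesσE`, the σE-rows and their boundary-blind transports); this file (the CUT 10:15:27Z of res-D-pv-047,
RE-BASED after the two drafts crossed — RULING (CU) named one file, p523041 reached the tree first) adds ONLY what that file lacks
and what res-type-040's Ω⁺ / res-L1-type-o1's `σ_ρ` asked for: (1) POINT-FREE boundary-threaded states and runs over part 2a
(`…Corridor3SigmaRuns.lean` p521892), (2) the LIFT of reachability along chains (o1's §5 has the one-step lift and the projection),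
(3) BOUNDARY-AWARE STAGE ORACLES `StageOracleE` with `IsCanonicalStepΩE` = res-type-040's `IsCanonicalStepΩ` (`…Corridor3SigmaCycleDefs.lean`)
reading `E`, and the boundary-BLIND embedding `StageOracle.withBoundary` with its transports. NOTHING is a statement of H. Hironaka's
manuscript [Hironaka2017] nor of Cossart–Jannsen–Saito; nothing is asserted beyond unfoldings and forget/lift bookkeeping.
AI-written; AI review is weaker than expert review.

## Contents (namespace `…Theorems.SigmaMaxModificationsCorridor3.Sigma`)

* §1 `StateσE` (= part 2a's `Stateσ` + boundary `E`), `StateσE.init X hX E₀`, `StateσE.toStateσ`, `MarkedStageE.toStateσE`; `StepσE σ N ν`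
  (point-free boundary-threaded step, next boundary `E.next C`), `StateReachesσE`; `CanonicalNearStepσE.stepσE`,
  `ReachesσE.stateReachesσE`; for a boundary-blind strategy: `StepσE.toStateσ`, `StateReachesσE.toStateσ`.
* §2 `Reachesσ.exists_liftE` — reachability of the underlying marked stage LIFTS along chains to `ReachesσE σ.withBoundary` from any
  boundary (o1's one-step `CanonicalNearStepσ.exists_liftE`, iterated); with o1's `ReachesσE.toMarkedStage` this makes
  `InScopeMσE p σ.withBoundary N ν E₀` and `InScopeMσ p σ N ν` correspond (`exists_liftE_of_inScopeMσ`).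
* §3 `IsRunFromσE σ N ν hW L P E s` — `s : CentreSeq W` is a boundary-threaded σ-run from `(W, L, P, E)` (part 2a's `IsRunFromσ` with
  `E` threaded by `Boundary.next`), `IsRunσE` (from the initial state with boundary `E₀`); RUN TRANSPORT for blind strategies
  `isRunFromσE_withBoundary_iff : IsRunFromσE σ.withBoundary N ν hW L P E s ↔ IsRunFromσ σ N ν hW L P s` (the boundary is OUTPUT-only).
* §4 `StageOracleE` (040's `StageOracle` whose `names` also reads `E`), `StageOracle.withBoundary`, `IsCanonicalStepΩE ω hW N ν L E P C P'`
  (040's `IsCanonicalStepΩ` VERBATIM with «`ω.names W hW N ν L`» ↦ «`ω.namesE W hW N ν L E`»), `StrategyE.ofStageOracleE`, and the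
  transports `isCanonicalStepΩE_withBoundary_iff` (per case `Iff.rfl`), `StrategyE.ofStageOracleE_step_iff`,
  `StrategyE.ofStageOracleE_withBoundary_step_iff` (the two embeddings commute pointwise), `Strategy.cjs_withBoundary_eq`
  (`(Strategy.cjs R).withBoundary = (Strategy.ofStageOracle (StageOracle.lift R)).withBoundary`, `rfl`) — so σ_CJS and every
  cycle-disciplined Ω sit inside the boundary-aware class DEFINITIONALLY, and `σ_ρ`'s `E`-frame hook is the `E` argument of `namesE`.

## References (context)

* V. Cossart, U. Jannsen, S. Saito, LNM 2270 (2020), Rem. 6.29 (1). [CossartJannsenSaito2020]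
* J. Kollár, *Lectures on Resolution of Singularities* (2007), Def. 3.65–3.66. [Kollar2007]
-/

noncomputable section

set_option linter.dupNamespace false -- mandated namespace of this single-conjunct summit

open CategoryTheory AlgebraicGeometry TopologicalSpace
open Summit.ResolutionOfSingularities.ResolutionOfSingularities.Theorems.CampaignW42
open Literature.AlgebraicGeometry.Resolution Literature.RingTheory.HilbertSamuel
open Literature.AlgebraicGeometry.CossartJannsenSaito2020
open Summit.ResolutionOfSingularities.ResolutionOfSingularities.Theorems.SigmaMaxModificationsCorridor3.Moving

namespace Summit.ResolutionOfSingularities.ResolutionOfSingularities.Theorems.SigmaMaxModificationsCorridor3.Sigma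

universe u

/-! ## §1. Boundary-threaded point-free states -/

/-- [OURS · L1 W4.2] A STATE WITH BOUNDARY: part 2a's `Stateσ` (stage, bookkeeping) plus the accumulated boundary `E`
(= res-L1-type-o1's `MarkedStageE` minus the marked point). [folklore] -/
structure StateσE : Type (u + 1) extends Stateσ.{u} where
  /-- the boundary of the stage -/
  E : Boundary W

/-- The initial state of `X` with a prescribed initial boundary `E₀` (scheme-side default `[]`). [folklore] -/
def StateσE.init (X : Scheme.{u}) (hX : IsLocallyNoetherian X) (E₀ : Boundary X) : StateσE.{u} :=
  ⟨Stateσ.init X hX, E₀⟩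

/-- Unfolding. [folklore] -/
@[simp] theorem StateσE.init_toStateσ (X : Scheme.{u}) (hX : IsLocallyNoetherian X) (E₀ : Boundary X) :
    (StateσE.init X hX E₀).toStateσ = Stateσ.init X hX := rfl

/-- Forget the marked point of a marked stage with boundary. [folklore] -/
def MarkedStageE.toStateσE (s : MarkedStageE.{u}) : StateσE.{u} :=
  ⟨s.toMarkedStage.toState, s.E⟩

/-- The two forgetful routes to a bare state agree. [folklore] -/
@[simp] theorem MarkedStageE.toStateσE_toStateσ (s : MarkedStageE.{u}) :
    s.toStateσE.toStateσ = s.toMarkedStage.toState := rfl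

/-- [OURS · L1 W4.2] ONE BOUNDARY-THREADED σ-STEP ON STATES (point-free): σ allows `(C, P')` reading `(L, P, E)`, the state moves to
`blowup C` with the updated labels, `P'`, and the boundary `E.next C`. [folklore] -/
def StepσE (σ : StrategyE.{u}) (N : ℕ) (ν : ℕ → ℕ) (t t' : StateσE.{u}) : Prop :=
  ∃ (C : t.W.IdealSheafData) (P' : Option (Pending (blowup C))) (h : IsLocallyNoetherian (blowup C)),
    σ.step t.W t.ln N ν t.L t.P t.E C P' ∧
      t' = ⟨⟨blowup C, h, t.L.next (Scheme.hsStratum t.W N ν) C, P'⟩, t.E.next C⟩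

/-- [OURS · L1 W4.2] Boundary-threaded reachability of states. [folklore] -/
def StateReachesσE (σ : StrategyE.{u}) (N : ℕ) (ν : ℕ → ℕ) : StateσE.{u} → StateσE.{u} → Prop :=
  Relation.ReflTransGen (StepσE σ N ν)

section States

variable {N : ℕ} {ν : ℕ → ℕ}

/-- A boundary-threaded near step is a boundary-threaded step of the point-free states. [folklore] -/
theorem CanonicalNearStepσE.stepσE {σ : StrategyE.{u}} {s s' : MarkedStageE.{u}} (h : CanonicalNearStepσE σ N ν s s') :
    StepσE σ N ν s.toStateσE s'.toStateσE := by
  obtain ⟨C, P', hln, x', hstep, -, -, -, rfl⟩ := h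
  exact ⟨C, P', hln, hstep, rfl⟩

/-- Reachability of marked stages with boundary gives reachability of their point-free states. [folklore] -/
theorem ReachesσE.stateReachesσE {σ : StrategyE.{u}} {s s' : MarkedStageE.{u}} (h : ReachesσE σ N ν s s') :
    StateReachesσE σ N ν s.toStateσE s'.toStateσE := by
  induction h with
  | refl => exact Relation.ReflTransGen.refl
  | tail _ hst ih => exact ih.tail hst.stepσE

/-- For a boundary-blind strategy a boundary-threaded step of states is a step of the underlying states. [folklore] -/
theorem StepσE.toStateσ {σ : Strategy.{u}} {t t' : StateσE.{u}} (h : StepσE σ.withBoundary N ν t t') :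
    Stepσ σ N ν t.toStateσ t'.toStateσ := by
  obtain ⟨C, P', hln, hstep, rfl⟩ := h
  exact ⟨C, P', hln, hstep, rfl⟩

/-- … and along chains. [folklore] -/
theorem StateReachesσE.toStateσ {σ : Strategy.{u}} {t t' : StateσE.{u}} (h : StateReachesσE σ.withBoundary N ν t t') :
    StateReachesσ σ N ν t.toStateσ t'.toStateσ := by
  induction h with
  | refl => exact Relation.ReflTransGen.refl
  | tail _ hst ih => exact ih.tail hst.toStateσ

end States

/-! ## §2. Lifting reachability along chains -/

section Lift

variable {σ : Strategy.{u}} {N : ℕ} {ν : ℕ → ℕ}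

/-- **Reachability of the underlying marked stage LIFTS along chains** to boundary-threaded reachability under `σ.withBoundary`, from any
boundary on the start (o1's one-step lift `CanonicalNearStepσ.exists_liftE`, iterated). [folklore] -/
theorem Reachesσ.exists_liftE (s : MarkedStageE.{u}) {t' : MarkedStage.{u}} (h : Reachesσ σ N ν s.toMarkedStage t') :
    ∃ s' : MarkedStageE.{u}, s'.toMarkedStage = t' ∧ ReachesσE σ.withBoundary N ν s s' := by
  induction h with
  | refl => exact ⟨s, rfl, Relation.ReflTransGen.refl⟩
  | tail _ hst ih =>
    obtain ⟨s₁, rfl, hreach⟩ := ih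
    obtain ⟨s₂, rfl, hstep⟩ := CanonicalNearStepσ.exists_liftE hst
    exact ⟨s₂, rfl, hreach.tail hstep⟩

/-- Hence a stage in scope for `σ` underlies a stage in scope for `σ.withBoundary`, for every initial-boundary assignment. [folklore] -/
theorem exists_liftE_of_inScopeMσ {p : ℕ} (E₀ : ∀ (X : Scheme.{u}), X → Boundary X) {t : MarkedStage.{u}}
    (h : InScopeMσ p σ N ν t) :
    ∃ s : MarkedStageE.{u}, s.toMarkedStage = t ∧ InScopeMσE p σ.withBoundary N ν E₀ s := by
  obtain ⟨X, hX, x, horig, hreach⟩ := h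
  obtain ⟨s, rfl, hreachE⟩ := Reachesσ.exists_liftE (⟨@MarkedStage.init X hX x, E₀ X x⟩ : MarkedStageE.{u}) hreach
  exact ⟨s, rfl, X, hX, x, horig, hreachE⟩

end Lift

/-! ## §3. Boundary-threaded runs -/

/-- [OURS · L1 W4.2] **`s` is a BOUNDARY-THREADED σ-RUN from `(W, L, P, E)`**: part 2a's `IsRunFromσ` with the strategy reading the
boundary and the boundary threaded by `Boundary.next`. [folklore] -/
def IsRunFromσE (σ : StrategyE.{u}) (N : ℕ) (ν : ℕ → ℕ) :
    ∀ {W : Scheme.{u}} (_ : IsLocallyNoetherian W), Labelling W → Option (Pending W) → Boundary W → CentreSeq W → Prop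
  | _, _, _, _, _, CentreSeq.nil _ => True
  | W, hW, L, P, E, CentreSeq.cons C rest =>
      ∃ P', σ.step W hW N ν L P E C P' ∧
        IsRunFromσE σ N ν (isLocallyNoetherian_blowup hW C) (L.next (Scheme.hsStratum W N ν) C) P' (E.next C) rest

/-- Unfolding: the empty run. [folklore] -/
@[simp] theorem isRunFromσE_nil {σ : StrategyE.{u}} {N : ℕ} {ν : ℕ → ℕ} {W : Scheme.{u}} (hW : IsLocallyNoetherian W)
    (L : Labelling W) (P : Option (Pending W)) (E : Boundary W) : IsRunFromσE σ N ν hW L P E (CentreSeq.nil W) := trivial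

/-- Unfolding: a run with a first centre. [folklore] -/
theorem isRunFromσE_cons_iff {σ : StrategyE.{u}} {N : ℕ} {ν : ℕ → ℕ} {W : Scheme.{u}} (hW : IsLocallyNoetherian W)
    (L : Labelling W) (P : Option (Pending W)) (E : Boundary W) (C : W.IdealSheafData) (rest : CentreSeq (blowup C)) :
    IsRunFromσE σ N ν hW L P E (CentreSeq.cons C rest) ↔
      ∃ P', σ.step W hW N ν L P E C P' ∧
        IsRunFromσE σ N ν (isLocallyNoetherian_blowup hW C) (L.next (Scheme.hsStratum W N ν) C) P' (E.next C) rest :=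
  Iff.rfl

/-- [OURS · L1 W4.2] `s` is a boundary-threaded σ-run from the INITIAL state of `X` with initial boundary `E₀`. [folklore] -/
def IsRunσE (σ : StrategyE.{u}) (N : ℕ) (ν : ℕ → ℕ) {X : Scheme.{u}} [hX : IsLocallyNoetherian X] (E₀ : Boundary X)
    (s : CentreSeq X) : Prop :=
  IsRunFromσE σ N ν hX (Labelling.init X) none E₀ s

/-- **RUN TRANSPORT**: for a boundary-blind strategy the boundary is output-only — boundary-threaded runs are exactly runs (induction
along the run; the step case is o1's `Strategy.withBoundary_step_iff`, `Iff.rfl`). [folklore] -/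
theorem isRunFromσE_withBoundary_iff {σ : Strategy.{u}} {N : ℕ} {ν : ℕ → ℕ} :
    ∀ {W : Scheme.{u}} (hW : IsLocallyNoetherian W) (L : Labelling W) (P : Option (Pending W)) (E : Boundary W)
      (s : CentreSeq W), IsRunFromσE σ.withBoundary N ν hW L P E s ↔ IsRunFromσ σ N ν hW L P s
  | _, _, _, _, _, CentreSeq.nil _ => Iff.rfl
  | W, hW, L, P, E, CentreSeq.cons C rest => by
    rw [isRunFromσE_cons_iff, isRunFromσ_cons_iff]
    exact exists_congr fun P' => and_congr Iff.rfl (isRunFromσE_withBoundary_iff _ _ P' (E.next C) rest)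

/-- In particular from the initial state. [folklore] -/
theorem isRunσE_withBoundary_iff {σ : Strategy.{u}} {N : ℕ} {ν : ℕ → ℕ} {X : Scheme.{u}} [IsLocallyNoetherian X]
    (E₀ : Boundary X) (s : CentreSeq X) : IsRunσE σ.withBoundary N ν E₀ s ↔ IsRunσ σ N ν s :=
  isRunFromσE_withBoundary_iff _ _ _ E₀ s

/-! ## §4. Boundary-aware stage oracles and the boundary-blind Ω-embedding -/

/-- [OURS · L1 W4.2] **A BOUNDARY-AWARE STAGE ORACLE**: res-type-040's `StageOracle` whose naming relation also READS the boundary `E` of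
the state — the hook for the model's `E`-frame corner data (`σ_ρ`). [folklore] -/
structure StageOracleE : Type (u + 1) where
  /-- the lower sequences the oracle names on the embedded part `φ : S ⟶ W` of the stage `W` in the state `(L, E)`, at level `N`,
  value `ν` -/
  namesE : ∀ (W : Scheme.{u}), IsLocallyNoetherian W → ℕ → (ℕ → ℕ) → Labelling W → Boundary W →
    ∀ (S : Scheme.{u}), (S ⟶ W) → CentreSeq S → Prop

/-- [OURS · L1 W4.2] Boundary-blind lift of a stage oracle (it ignores `E`). [folklore] -/
def StageOracle.withBoundary (ω : StageOracle.{u}) : StageOracleE.{u} :=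
  ⟨fun W hW N ν L _ S φ t => ω.names W hW N ν L S φ t⟩

/-- Unfolding (`Iff.rfl`). [folklore] -/
@[simp] theorem StageOracle.withBoundary_namesE_iff (ω : StageOracle.{u}) (W : Scheme.{u}) (hW : IsLocallyNoetherian W) (N : ℕ)
    (ν : ℕ → ℕ) (L : Labelling W) (E : Boundary W) (S : Scheme.{u}) (φ : S ⟶ W) (t : CentreSeq S) :
    ω.withBoundary.namesE W hW N ν L E S φ t ↔ ω.names W hW N ν L S φ t :=
  Iff.rfl

section StepΩE

variable {W : Scheme.{u}}

/-- [OURS · L1 W4.2] **ONE STEP OF THE CYCLE-DISCIPLINED SEQUENCE DRIVEN BY A BOUNDARY-AWARE STAGE ORACLE** — res-type-040's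
`IsCanonicalStepΩ` VERBATIM with «`ω.names W hW N ν L`» replaced by «`ω.namesE W hW N ν L E`» (cycle discipline of CJS Rem. 6.29 (1):
between cycles start the cycle of the least non-empty label with the oracle's sequence on the reduced part, inside a cycle replay).
NOT a statement of the manuscript. [cite: CossartJannsenSaito2020, Rem. 6.29 (1)] -/
def IsCanonicalStepΩE (ω : StageOracleE.{u}) (hW : IsLocallyNoetherian W) (N : ℕ) (ν : ℕ → ℕ) (L : Labelling W)
    (E : Boundary W) : Option (Pending W) → (C : W.IdealSheafData) → Option (Pending (blowup C)) → Prop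
  | none, C, P' =>
      ∃ j, IsLeast {i | (L.part (Scheme.hsStratum W N ν) i).Nonempty} j ∧
        ∃ h : IsClosed (L.part (Scheme.hsStratum W N ν) j),
          ∃ t : CentreSeq
              (Scheme.IdealSheafData.vanishingIdeal ⟨L.part (Scheme.hsStratum W N ν) j, h⟩).subscheme,
            ω.namesE W hW N ν L E _
                (Scheme.IdealSheafData.vanishingIdeal ⟨L.part (Scheme.hsStratum W N ν) j, h⟩).subschemeι t ∧
              IsReplayStep L (Scheme.hsStratum W N ν) j
                (Scheme.IdealSheafData.vanishingIdeal ⟨L.part (Scheme.hsStratum W N ν) j, h⟩).subschemeι t C P'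
  | some P, C, P' =>
      (Scheme.hsStratum W N ν).Nonempty ∧ IsReplayStep L (Scheme.hsStratum W N ν) P.lbl P.hom P.rest C P'

/-- **Boundary-blind oracles step as before**: `IsCanonicalStepΩE ω.withBoundary … E = IsCanonicalStepΩ ω …` (per case `Iff.rfl`).
[folklore] -/
theorem isCanonicalStepΩE_withBoundary_iff (ω : StageOracle.{u}) (hW : IsLocallyNoetherian W) (N : ℕ) (ν : ℕ → ℕ)
    (L : Labelling W) (E : Boundary W) (P : Option (Pending W)) (C : W.IdealSheafData) (P' : Option (Pending (blowup C))) :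
    IsCanonicalStepΩE ω.withBoundary hW N ν L E P C P' ↔ IsCanonicalStepΩ ω hW N ν L P C P' := by
  cases P <;> exact Iff.rfl

end StepΩE

/-- [OURS · L1 W4.2] **THE BOUNDARY-AWARE STRATEGY OF A BOUNDARY-AWARE STAGE ORACLE** (cycle discipline verbatim, in-cycle job by `ω`
reading `E`; the next boundary is still `E.next C`, chosen by nobody). NOT a statement of the manuscript.
[cite: CossartJannsenSaito2020, Rem. 6.29 (1)] -/
def StrategyE.ofStageOracleE (ω : StageOracleE.{u}) : StrategyE.{u} :=
  ⟨fun _ hW N ν L P E C P' => IsCanonicalStepΩE ω hW N ν L E P C P'⟩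

/-- Unfolding (`Iff.rfl`). [folklore] -/
theorem StrategyE.ofStageOracleE_step_iff (ω : StageOracleE.{u}) (W : Scheme.{u}) (hW : IsLocallyNoetherian W) (N : ℕ)
    (ν : ℕ → ℕ) (L : Labelling W) (P : Option (Pending W)) (E : Boundary W) (C : W.IdealSheafData)
    (P' : Option (Pending (blowup C))) :
    (StrategyE.ofStageOracleE ω).step W hW N ν L P E C P' ↔ IsCanonicalStepΩE ω hW N ν L E P C P' :=
  Iff.rfl

/-- **The two embeddings commute** (pointwise): the boundary-aware strategy of a boundary-blind oracle steps exactly like the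
boundary-blind lift of its strategy. [folklore] -/
theorem StrategyE.ofStageOracleE_withBoundary_step_iff (ω : StageOracle.{u}) (W : Scheme.{u}) (hW : IsLocallyNoetherian W)
    (N : ℕ) (ν : ℕ → ℕ) (L : Labelling W) (P : Option (Pending W)) (E : Boundary W) (C : W.IdealSheafData)
    (P' : Option (Pending (blowup C))) :
    (StrategyE.ofStageOracleE ω.withBoundary).step W hW N ν L P E C P' ↔
      (Strategy.ofStageOracle ω).withBoundary.step W hW N ν L P E C P' :=
  isCanonicalStepΩE_withBoundary_iff ω hW N ν L E P C P'

/-- `σ_CJS(R)` inside the boundary-aware class: `(Strategy.cjs R).withBoundary = (Strategy.ofStageOracle (StageOracle.lift R)).withBoundary`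
(`rfl`, from res-type-040's `Strategy.cjs_eq_ofStageOracle_lift`). [folklore] -/
theorem Strategy.cjs_withBoundary_eq (R : ∀ S : Scheme.{u}, CentreSeq S → Prop) :
    (Strategy.cjs R).withBoundary = (Strategy.ofStageOracle (StageOracle.lift R)).withBoundary :=
  rfl

/-- **A FUNCTIONAL boundary-aware stage oracle** (at most one named sequence per embedded part of each state with boundary).
[folklore] -/
def OracleFunctionalΩE (ω : StageOracleE.{u}) : Prop :=
  ∀ (W : Scheme.{u}) (hW : IsLocallyNoetherian W) (N : ℕ) (ν : ℕ → ℕ) (L : Labelling W) (E : Boundary W) (S : Scheme.{u})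
    (φ : S ⟶ W) (t₁ t₂ : CentreSeq S), ω.namesE W hW N ν L E S φ t₁ → ω.namesE W hW N ν L E S φ t₂ → t₁ = t₂

/-- A functional stage oracle lifts to a functional boundary-aware one. [folklore] -/
theorem oracleFunctionalΩE_withBoundary {ω : StageOracle.{u}} (hω : OracleFunctionalΩ ω) : OracleFunctionalΩE ω.withBoundary :=
  fun W hW N ν L _ S φ t₁ t₂ h₁ h₂ => hω W hW N ν L S φ t₁ t₂ h₁ h₂

section FunctionalΩE

variable {W : Scheme.{u}} {ω : StageOracleE.{u}} {hW : IsLocallyNoetherian W} {N : ℕ} {ν : ℕ → ℕ}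

/-- For a functional boundary-aware stage oracle the ΩE-step from a given state has a well-determined centre (port of res-type-040's
`IsCanonicalStepΩ.centre_unique`). [cite: CossartJannsenSaito2020, Rem. 6.29 (1)] -/
theorem IsCanonicalStepΩE.centre_unique (hω : OracleFunctionalΩE ω) {L : Labelling W} {E : Boundary W} {P : Option (Pending W)}
    {C₁ C₂ : W.IdealSheafData} {P₁ : Option (Pending (blowup C₁))} {P₂ : Option (Pending (blowup C₂))}
    (h₁ : IsCanonicalStepΩE ω hW N ν L E P C₁ P₁) (h₂ : IsCanonicalStepΩE ω hW N ν L E P C₂ P₂) : C₁ = C₂ := by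
  cases P with
  | none =>
    obtain ⟨j₁, hj₁, hcl₁, t₁, hR₁, hs₁⟩ := h₁
    obtain ⟨j₂, hj₂, hcl₂, t₂, hR₂, hs₂⟩ := h₂
    obtain rfl : j₁ = j₂ := hj₁.unique hj₂
    obtain rfl : t₁ = t₂ := hω _ _ _ _ _ _ _ _ _ _ hR₁ hR₂
    exact hs₁.centre_unique hs₂
  | some P => exact IsReplayStep.centre_unique h₁.2 h₂.2

/-- … and a well-determined next cycle state (port of `IsCanonicalStepΩ.pending_unique`). [cite: CossartJannsenSaito2020, Rem. 6.29 (1)] -/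
theorem IsCanonicalStepΩE.pending_unique (hω : OracleFunctionalΩE ω) {L : Labelling W} {E : Boundary W} {P : Option (Pending W)}
    {C : W.IdealSheafData} {P₁ P₂ : Option (Pending (blowup C))}
    (h₁ : IsCanonicalStepΩE ω hW N ν L E P C P₁) (h₂ : IsCanonicalStepΩE ω hW N ν L E P C P₂) : P₁ = P₂ := by
  cases P with
  | none =>
    obtain ⟨j₁, hj₁, hcl₁, t₁, hR₁, hs₁⟩ := h₁
    obtain ⟨j₂, hj₂, hcl₂, t₂, hR₂, hs₂⟩ := h₂
    obtain rfl : j₁ = j₂ := hj₁.unique hj₂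
    obtain rfl : t₁ = t₂ := hω _ _ _ _ _ _ _ _ _ _ hR₁ hR₂
    exact hs₁.pending_unique hs₂
  | some P =>
    haveI := P.isClosedImmersion
    exact IsReplayStep.pending_unique h₁.2 h₂.2

end FunctionalΩE

/-- **The boundary-aware strategy of a FUNCTIONAL boundary-aware stage oracle is functional** (o1's `StrategyE.IsFunctional`).
[cite: CossartJannsenSaito2020, Rem. 6.29 (1)] -/
theorem StrategyE.isFunctional_ofStageOracleE {ω : StageOracleE.{u}} (hω : OracleFunctionalΩE ω) (N : ℕ) (ν : ℕ → ℕ) :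
    (StrategyE.ofStageOracleE ω).IsFunctional N ν :=
  fun _ _ _ _ _ =>
    ⟨fun _ _ _ _ h₁ h₂ => IsCanonicalStepΩE.centre_unique hω h₁ h₂,
      fun _ _ _ h₁ h₂ => IsCanonicalStepΩE.pending_unique hω h₁ h₂⟩

end Summit.ResolutionOfSingularities.ResolutionOfSingularities.Theorems.SigmaMaxModificationsCorridor3.Sigma

end
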